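import Summits.ValiantsHypothesis.ValiantsHypothesis.Theorems.FifoMatchingNNDivisionHardLocalizationDeletion

/-!
# FifoMatching · NNDivisionHard — localization, part 3/4: §7 the SWITCHING functor `Sw`, §8 the diagonal permutahedron `Q^Π_λ ∈ Sw DelLocated`

Theorems-grade port (bytes staged by val-idea-43 g5 for a port hand) of the crux workfile `Cruxes/NNDivisionHard/Localization43.lean` rev 5
@6763e14e8ba5 (val-idea-43 g5, W6-P2 co-seat; crux `stmt-ValiantsHypothesis-21181` `FifoMatching.NNDivisionHard`; crit-9 g2 V#47 / V#53 VERIFIED KEEP) —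
the full commentary (enemy readings N19–N23, currency remarks, honest weight) stays in that workfile's module docstring; statements and
proofs below are VERBATIM, the namespace is `…Theorems.FifoMatching.Localization` and `T` is a local `abbrev` δ-equal to `XcDivision.T`.

Part 3: §7 `swLin` (`L_a`), `swLin_image_cor_add`, ★★ `decided_sw : Decided X → Decided (Sw X)` (same threshold), `Orb`, `decided_orb`,
★★★ `corVirtualHard_of_residualLawOrb`, N22 `enemy_not_sw`; §8 `qPerm`, ★ `sum_mul_perm_lt`, ★★ `qPerm_swDelLocated`, ★★★ `diagPermutahedron_decided`.
-/

set_option linter.unusedVariables false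
set_option linter.unusedSectionVars false
set_option linter.dupNamespace false

namespace Summit.ValiantsHypothesis.ValiantsHypothesis.Theorems.FifoMatching.Localization

open Matrix Finset
open scoped Pointwise
open Literature.Barriers.PneNP (HasEFOfSize corPolytopeGraph_top_two_pow_half_le)
open Literature.Combinatorics.Optimization (corPolytopeGraph corVec corVec_apply_diag corVec_apply_adj corVec_zero_or_one)
open Summit.ValiantsHypothesis.ValiantsHypothesis.Theorems.FifoMatching (XcDivision.dot_le_of_mem_convexHull XcDivision.convexHull_range_inter_eq)
open Summit.ValiantsHypothesis.ValiantsHypothesis.Theorems.FifoMatching.CorSandwich (threshold_lt_of_rpow_bound)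

/-! ## §7 SWITCHING: every decided class is closed under the switching symmetry of `COR(K_h)` — a second free functor, at NO cost in scale

The switching `σ_a` at vertex `a` (`b ↦ b` with coordinate `a` flipped) is an AFFINE AUTOMORPHISM of `COR(K_h)`: `σ_a(x) = L_a x + E_{aa}` with
the linear part `L_a` below (`x_{aa} ↦ −x_{aa}`, `x_{ia} ↦ x_{ii} − x_{ia}`, `x_{aj} ↦ x_{jj} − x_{aj}`, other entries fixed).  Hence
`xc(COR + conv q) = xc(σ_a(COR + conv q)) = xc(COR + conv(L_a q))`: reading the PASSENGER through `L_a` costs nothing, and for any class `X`,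
`Decided X → Decided (Sw X)` with `Sw X h q :≡ ∃ a, X h (L_a ∘ q)` and the SAME threshold (no currency exchange, unlike §3).  With §3 this gives
the pen the orbit calculus «decided ⇒ decided on every √h minor AND after every switching» for all fifteen classes by ONE theorem each, and the
enemy reading N22 (`enemy_not_sw`).  (CLASS W `SwitchLocated` of rev 17 is, up to the adjoint `L_aᵀ` on the functional, the `Sw`-image of the
exact-tightness variant of §6's `DelLocated`; we do not type that dictionary here.) -/

/-- flip coordinate `a`. -/
def flipAt {h : ℕ} (a : Fin h) (b : Fin h → Bool) : Fin h → Bool := Function.update b a (!b a)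

/-- `flipAt a b a = !b a`. -/
theorem flipAt_apply_self {h : ℕ} (a : Fin h) (b : Fin h → Bool) : flipAt a b a = !b a := by
  simp [flipAt]

/-- `flipAt a b i = b i` for `i ≠ a`. -/
theorem flipAt_apply_ne {h : ℕ} (a : Fin h) (b : Fin h → Bool) {i : Fin h} (hi : i ≠ a) : flipAt a b i = b i := by
  simp [flipAt, hi]

/-- the coordinate flip is an involution. -/
theorem flipAt_flipAt {h : ℕ} (a : Fin h) (b : Fin h → Bool) : flipAt a (flipAt a b) = b := by
  funext i
  by_cases hi : i = a
  · subst hi; rw [flipAt_apply_self, flipAt_apply_self, Bool.not_not]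
  · rw [flipAt_apply_ne a _ hi, flipAt_apply_ne a _ hi]

/-- the LINEAR PART of the switching of `COR(K_h)` at vertex `a`. -/
def swLin {h : ℕ} (a : Fin h) : (Fin h × Fin h → ℝ) →ₗ[ℝ] (Fin h × Fin h → ℝ) where
  toFun x := fun p =>
    if p.1 = a ∧ p.2 = a then -x (a, a)
    else if p.2 = a then x (p.1, p.1) - x p
    else if p.1 = a then x (p.2, p.2) - x p
    else x p
  map_add' := by
    intro x y; funext p; simp only [Pi.add_apply]; split_ifs <;> ring
  map_smul' := by
    intro c x; funext p; simp only [Pi.smul_apply, smul_eq_mul, RingHom.id_apply]; split_ifs <;> ring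

/-- entrywise formula of the switching map `L_a`. -/
theorem swLin_apply {h : ℕ} (a : Fin h) (x : Fin h × Fin h → ℝ) (p : Fin h × Fin h) :
    swLin a x p = (if p.1 = a ∧ p.2 = a then -x (a, a)
      else if p.2 = a then x (p.1, p.1) - x p
      else if p.1 = a then x (p.2, p.2) - x p
      else x p) := rfl

/-- `E_{aa}`. -/
def diagUnit {h : ℕ} (a : Fin h) : Fin h × Fin h → ℝ := fun p => if p = (a, a) then 1 else 0

/-- ★ the switching acts on the vertices of `COR(K_h)`: `L_a (bbᵀ) + E_{aa} = b'b'ᵀ`, `b' = b` with coordinate `a` flipped. -/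
theorem swLin_corVec {h : ℕ} (a : Fin h) (b : Fin h → Bool) :
    swLin a (corVec (⊤ : SimpleGraph (Fin h)) b) + diagUnit a = corVec (⊤ : SimpleGraph (Fin h)) (flipAt a b) := by
  funext p
  obtain ⟨i, j⟩ := p
  simp only [Pi.add_apply, swLin_apply, corVec_top_apply, diagUnit, Prod.mk.injEq]
  by_cases hi : i = a <;> by_cases hj : j = a
  · rw [hi, hj]
    simp only [and_self, if_true, flipAt_apply_self]
    cases b a <;> simp
  · rw [hi]
    simp only [hj, and_false, if_false, if_true, flipAt_apply_self, flipAt_apply_ne a b hj]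
    cases b a <;> cases b j <;> simp
  · rw [hj]
    simp only [hi, false_and, if_false, if_true, flipAt_apply_self, flipAt_apply_ne a b hi]
    cases b a <;> cases b i <;> simp
  · simp only [hi, hj, and_self, if_false, flipAt_apply_ne a b hi, flipAt_apply_ne a b hj]
    simp

/-- ★ `L_a(COR(K_h)) + E_{aa} = COR(K_h)`: the switching is an affine automorphism of the correlation polytope. -/
theorem swLin_image_cor_add {h : ℕ} (a : Fin h) :
    swLin a '' corPolytopeGraph (⊤ : SimpleGraph (Fin h)) + {diagUnit a} = corPolytopeGraph (⊤ : SimpleGraph (Fin h)) := by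
  unfold corPolytopeGraph
  rw [LinearMap.image_convexHull, ← Set.range_comp, ← convexHull_singleton (𝕜 := ℝ) (diagUnit a), ← convexHull_add,
    Set.add_singleton, ← Set.range_comp]
  congr 1
  ext y
  constructor
  · rintro ⟨b, rfl⟩
    exact ⟨flipAt a b, by simp only [Function.comp]; rw [swLin_corVec]⟩
  · rintro ⟨b, rfl⟩
    refine ⟨flipAt a b, ?_⟩
    simp only [Function.comp]
    rw [swLin_corVec, flipAt_flipAt]


/-- the SWITCHED class: the passenger read through one switching `L_a`. -/
def Sw (X : PClass) : PClass := fun h K q => ∃ a : Fin h, X h K (⇑(swLin a) ∘ q)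

/-- ★ TRANSPORT: an EF of the pair is an EF of the switched pair (same size). -/
theorem hasEFOfSize_pair_sw {h K : ℕ} (a : Fin h) (q : Fam h K) {r : ℕ}
    (hEF : HasEFOfSize (corPolytopeGraph (⊤ : SimpleGraph (Fin h)) + convexHull ℝ (Set.range q)) r) :
    HasEFOfSize (corPolytopeGraph (⊤ : SimpleGraph (Fin h)) + convexHull ℝ (Set.range (⇑(swLin a) ∘ q))) r := by
  have h1 := (hEF.image_linearMap (swLin a)).image_add_const (diagUnit a)
  rw [Set.image_add, LinearMap.image_convexHull, ← Set.range_comp, ← Set.add_singleton, add_right_comm,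
    swLin_image_cor_add] at h1
  exact h1

/-- an EF of `conv q` is an EF of `conv (L_a ∘ q)` of the same size (linear image). -/
theorem hasEFOfSize_hull_sw {h K : ℕ} (a : Fin h) (q : Fam h K) {r : ℕ}
    (hEF : HasEFOfSize (convexHull ℝ (Set.range q)) r) :
    HasEFOfSize (convexHull ℝ (Set.range (⇑(swLin a) ∘ q))) r := by
  have h1 := hEF.image_linearMap (swLin a)
  rwa [LinearMap.image_convexHull, ← Set.range_comp] at h1

/-- ★★ **SWITCHING THEOREM.** `Decided X → Decided (Sw X)`, same threshold. -/
theorem decided_sw {X : PClass} (hX : Decided X) : Decided (Sw X) := by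
  intro c
  obtain ⟨h₀, H⟩ := hX c
  refine ⟨h₀, fun h hh K q r hq hEF => ?_⟩
  obtain ⟨a, ha⟩ := hq
  exact H h hh K _ r ha (hasEFOfSize_pair_sw a q hEF)

/-- budgeted version. -/
theorem decidedB_sw {X : PClass} (hX : DecidedB X) : DecidedB (Sw X) := by
  intro c
  obtain ⟨h₀, H⟩ := hX c
  refine ⟨h₀, fun h hh K q r hq hB hEF => ?_⟩
  obtain ⟨a, ha⟩ := hq
  exact H h hh K _ r ha (hasEFOfSize_hull_sw a q hB) (hasEFOfSize_pair_sw a q hEF)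

/-- the ORBIT STEP of a class: as read, or after one switching, on a `√h` deletion minor. -/
def Orb (X : PClass) : PClass := Loc (fun h K q => X h K q ∨ Sw X h K q)

/-- `Decided X → Decided (Orb X)`: localization after the switching closure, exchange `c ↦ 2c`. -/
theorem decided_orb {X : PClass} (hX : Decided X) : Decided (Orb X) :=
  decided_loc (decided_or hX (decided_sw hX))

/-- `X ⊆ Orb X`. -/
theorem le_orb {X : PClass} {h K : ℕ} {q : Fam h K} (hq : X h K q) : Orb X h K q :=
  le_loc (fun h K q => X h K q ∨ Sw X h K q) (Or.inl hq)

/-- ★★★ **GLUE (orbit form).**  For the pen: with `X := Decided₁₅` (the disjunction of the fifteen decided classes) it suffices to prove the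
residual law on families that are residual AS READ, AFTER EVERY SWITCHING, ON EVERY `√h` DELETION MINOR. -/
theorem corVirtualHard_of_residualLawOrb {X : PClass} (hX : Decided X) (hR : ResidualLaw (Orb X)) : CorVirtualHard :=
  corVirtualHard_of_residualLaw (decided_orb hX) hR

/-- **N22 (enemy side)**: below the threshold, no switching of the passenger (read on any `√h` minor) lands in a decided class. -/
theorem enemy_not_sw {X : PClass} (hX : Decided X) (c : ℕ) :
    ∃ h₀ : ℕ, ∀ h ≥ h₀, ∀ (K : ℕ) (q : Fam h K) (r : ℕ),
      HasEFOfSize (corPolytopeGraph (⊤ : SimpleGraph (Fin h)) + convexHull ℝ (Set.range q)) r → r ≤ T c h →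
      ∀ ℓ : ℕ, Nat.sqrt h ≤ ℓ → ∀ ι : Fin ℓ ↪ Fin h, ∀ a : Fin ℓ, ¬ X ℓ K (⇑(swLin a) ∘ (⇑(delRead ι) ∘ q)) := by
  obtain ⟨h₀, hh₀⟩ := enemy_hereditary (decided_sw hX) c
  refine ⟨h₀, fun h hh K q r hEF hr ℓ hℓ ι a hq => hh₀ h hh K q r hEF hr ℓ hℓ ι ⟨a, hq⟩⟩

/-- e.g. switched deletion-located families are decided (functional tight on a SWITCHED deletion face `{b_{x₀} = 1}`-type configurations). -/
theorem swDelLocated_decided : Decided (Sw DelLocated) := decided_sw delLocated_decided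

/-! ## §8 THE DIAGONAL PERMUTAHEDRON `Q^Π_λ` IS IN `Sw DelLocated` — decided in face currency (crit-9 g2 22:52:44Z, «the open question of wave 6»)

`Q^Π_λ = conv{−λ·diag(π) : π ∈ S_h}` (Goemans: xc `O(h log h)`).  After the switching at any vertex `a`, the passenger point `L_a q_π` carries
the diagonal in COLUMN `a` (`(L_a q_π)_{ia} = (q_π)_{ii} = −λ(π(i)+1)`), and N20's NEGATIVE COLUMN TILT `W = −Σ_l ω(l) E_{l a}` with `ω` a
bijection `Fin h → {0,…,h−1}`, `ω(a) = 0`, evaluates to `λ Σ_l ω(l)(π(l)+1)` — UNIQUELY maximised at `π = ω` by the square identity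
`Σ ω_l π_l = Σ_k k² − ½ Σ_l (ω_l − π_l)²`.  Hence `Q^Π_λ ∈ Sw DelLocated` (`qPerm_swDelLocated`) and ★★ `diagPermutahedron_decided`: in xc /
face currency `Q^Π_λ` is NOT an enemy — `xc(COR(K_h) + Q^Π_λ) > T c h`.  Unswitched, the same certificate is the functional
`C = M·E_{aa} + Σ_{i≠a} ω(i)(E_{ia} − E_{ii})` (valid on `COR`, max `M` iff `b_a = 1`, unique maximising permutation `ω`): `Q^Π_λ` is literally in
CLASS W `SwitchLocated` of LINE rev 17 as well (paper; three lines).  LAW-CURRENCY READING (paper, for crit-9's `M_{a,σ}` question): these are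
located rows `(a′, C)` at the SWITCHED face `{b_a = 1}`; with EXACT rhs (`pinnedRows`, S = {a}) their slack on the window `{b ∋ a} × {ω}` is
`(1 − |a′∩b|)²` = UDISJ_{h−1} (so exact-rhs located pencils DECIDE `Q^Π`); with BOX rhs (`entryTilted` = C⁺_entry literal) the off-diagonal
entries `+ω(i)E_{ia}` add the constant `D = Σ_{i≠a} ω(i) = h(h−1)/2 ≥ h − 1` on the window and `(1−t)² + D = (D+1−t) + t(t−1)` has nonneg rank
`≤ (2h+1) + h²` — box-blind, consistent with crit-9's reduction of C⁺_entry-blindness of `Q^Π` to `rank₊ M_{a,σ}`. -/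

/-- the diagonal permutation passenger point `q_π = −λ·diag(π(i)+1)`. -/
def qPerm {h : ℕ} (lam : ℝ) (π : Equiv.Perm (Fin h)) : Fin h × Fin h → ℝ :=
  fun p => if p.1 = p.2 then -(lam * (((π p.1 : ℕ) : ℝ) + 1)) else 0

/-- column `a` of the switched diagonal point `L_a (qPerm λ π)`. -/
theorem swLin_qPerm_col {h : ℕ} (a : Fin h) (lam : ℝ) (π : Equiv.Perm (Fin h)) (l : Fin h) :
    swLin a (qPerm lam π) (l, a) =
      if l = a then lam * (((π a : ℕ) : ℝ) + 1) else -(lam * (((π l : ℕ) : ℝ) + 1)) := by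
  rw [swLin_apply]
  unfold qPerm
  by_cases hl : l = a
  · simp [hl]
  · simp [hl]

/-- the column tilt `−Σ_l ω(l) E_{la}` evaluated on the switched permutation point. -/
theorem colTilt_sw_qPerm {h : ℕ} (a : Fin h) (ω : Equiv.Perm (Fin h)) (hωa : ((ω a : ℕ) : ℝ) = 0) (lam : ℝ)
    (π : Equiv.Perm (Fin h)) :
    colTilt a (fun l => ((ω l : ℕ) : ℝ)) ⬝ᵥ swLin a (qPerm lam π) =
      lam * ∑ l, ((ω l : ℕ) : ℝ) * (((π l : ℕ) : ℝ) + 1) := by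
  rw [colTilt_dotProduct, Finset.mul_sum, ← Finset.sum_neg_distrib]
  refine Finset.sum_congr rfl fun l _ => ?_
  rw [swLin_qPerm_col]
  by_cases hl : l = a
  · subst hl
    rw [if_pos rfl, hωa]
    ring
  · rw [if_neg hl]
    ring

/-- `Σ_l π(l)² = Σ_l l²` for a permutation `π` (reindexing). -/
theorem sum_sq_perm {h : ℕ} (π : Equiv.Perm (Fin h)) :
    ∑ l, (((π l : ℕ) : ℝ)) ^ 2 = ∑ l : Fin h, ((l : ℕ) : ℝ) ^ 2 :=
  Equiv.sum_comp π (fun k : Fin h => ((k : ℕ) : ℝ) ^ 2)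

/-- ★ the square identity: `Σ ω_l π_l < Σ ω_l²` for permutations `π ≠ ω`. -/
theorem sum_mul_perm_lt {h : ℕ} (ω π : Equiv.Perm (Fin h)) (hne : π ≠ ω) :
    ∑ l, ((ω l : ℕ) : ℝ) * ((π l : ℕ) : ℝ) < ∑ l, ((ω l : ℕ) : ℝ) * ((ω l : ℕ) : ℝ) := by
  have hsq : 0 < ∑ l, (((ω l : ℕ) : ℝ) - ((π l : ℕ) : ℝ)) ^ 2 := by
    obtain ⟨l₀, hl₀⟩ : ∃ l, π l ≠ ω l := by
      by_contra hcon
      push Not at hcon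
      exact hne (Equiv.ext hcon)
    refine Finset.sum_pos' (fun l _ => sq_nonneg _) ⟨l₀, Finset.mem_univ _, ?_⟩
    have hd : ((ω l₀ : ℕ) : ℝ) - ((π l₀ : ℕ) : ℝ) ≠ 0 := by
      intro h0
      apply hl₀
      have : ((π l₀ : ℕ) : ℝ) = ((ω l₀ : ℕ) : ℝ) := by linarith
      exact Fin.ext (by exact_mod_cast this)
    rw [pow_two]
    exact mul_self_pos.2 hd
  have hexp : ∀ l : Fin h, (((ω l : ℕ) : ℝ) - ((π l : ℕ) : ℝ)) ^ 2 =
      ((ω l : ℕ) : ℝ) ^ 2 - 2 * (((ω l : ℕ) : ℝ) * ((π l : ℕ) : ℝ)) + ((π l : ℕ) : ℝ) ^ 2 := fun l => by ring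
  simp only [hexp, Finset.sum_add_distrib, Finset.sum_sub_distrib, ← Finset.mul_sum] at hsq
  rw [sum_sq_perm π, ← sum_sq_perm ω] at hsq
  have h2 : ∑ l, ((ω l : ℕ) : ℝ) * ((ω l : ℕ) : ℝ) = ∑ l, ((ω l : ℕ) : ℝ) ^ 2 :=
    Finset.sum_congr rfl fun l _ => by ring
  rw [h2]
  linarith

/-- ★★ `Q^Π_λ ∈ Sw DelLocated`: for any listing `e` of permutations containing some `ω` with `ω(a) = 0`. -/
theorem qPerm_swDelLocated {h K : ℕ} (lam : ℝ) (hlam : 0 < lam) (a : Fin h) (ω : Equiv.Perm (Fin h))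
    (hωa : (ω a : ℕ) = 0) (e : Fin (K + 1) → Equiv.Perm (Fin h)) (j₀ : Fin (K + 1)) (hj₀ : e j₀ = ω) :
    Sw DelLocated h K (fun j => qPerm lam (e j)) := by
  have hωa' : ((ω a : ℕ) : ℝ) = 0 := by exact_mod_cast hωa
  refine ⟨a, delLocated_of_colTilt _ a (fun l => ((ω l : ℕ) : ℝ)) (fun l => by positivity) j₀ fun j => ?_⟩
  by_cases hj : e j = ω
  · right
    simp only [Function.comp_apply, hj, hj₀]
  · left
    simp only [Function.comp_apply]
    rw [colTilt_sw_qPerm a ω hωa', colTilt_sw_qPerm a ω hωa', hj₀]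
    refine mul_lt_mul_of_pos_left ?_ hlam
    have hlt := sum_mul_perm_lt ω (e j) hj
    have hω : ∑ l, ((ω l : ℕ) : ℝ) * (((ω l : ℕ) : ℝ) + 1) = ∑ l, ((ω l : ℕ) : ℝ) * ((ω l : ℕ) : ℝ) + ∑ l, ((ω l : ℕ) : ℝ) := by
      rw [← Finset.sum_add_distrib]
      exact Finset.sum_congr rfl fun l _ => by ring
    have hπ : ∑ l, ((ω l : ℕ) : ℝ) * (((e j l : ℕ) : ℝ) + 1) = ∑ l, ((ω l : ℕ) : ℝ) * ((e j l : ℕ) : ℝ) + ∑ l, ((ω l : ℕ) : ℝ) := by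
      rw [← Finset.sum_add_distrib]
      exact Finset.sum_congr rfl fun l _ => by ring
    rw [hω, hπ]
    linarith

/-- ★★★ **THE DIAGONAL PERMUTAHEDRON IS DECIDED (face / xc currency).**  For every `λ > 0` and every listing of `S_h` onto the passenger index:
`xc(COR(K_h) + Q^Π_λ) > T c h` for `h ≥ h₀(c)` — by §7 (switch at vertex `0`) + §6 (column tilt `−Σ_l l·E_{l0}`, unique maximiser `π = id`). -/
theorem diagPermutahedron_decided (lam : ℝ) (hlam : 0 < lam) :
    ∀ c : ℕ, ∃ h₀ : ℕ, ∀ h ≥ h₀, ∀ (K : ℕ) (e : Fin (K + 1) → Equiv.Perm (Fin h)), Function.Surjective e → ∀ r : ℕ,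
      HasEFOfSize (corPolytopeGraph (⊤ : SimpleGraph (Fin h)) + convexHull ℝ (Set.range fun j => qPerm lam (e j))) r →
      T c h < r := by
  intro c
  obtain ⟨h₀, H⟩ := swDelLocated_decided c
  refine ⟨h₀ + 1, fun h hh K e he r hEF => H h (by omega) K _ r ?_ hEF⟩
  have hpos : 0 < h := by omega
  obtain ⟨j₀, hj₀⟩ := he (Equiv.refl _)
  exact qPerm_swDelLocated lam hlam ⟨0, hpos⟩ (Equiv.refl _) (by simp) e j₀ hj₀

end Summit.ValiantsHypothesis.ValiantsHypothesis.Theorems.FifoMatching.Localization
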